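import Mathlib.Algebra.Group.TransferInstance
import Mathlib.Algebra.Order.Monoid.Prod
import Mathlib.Data.Prod.Lex
import Mathlib.Data.Finsupp.MonomialOrder
import Mathlib.Data.Finsupp.Weight
import Mathlib.RingTheory.MvPolynomial.MonomialOrder
import Mathlib.RingTheory.MvPolynomial.WeightedHomogeneous
import HarnessLib

/-!
# Weight monomial orders `≺_w`: compare the `w`-weight first, then break ties by a monomial order

For a weight vector `w : σ → ℕ` and a monomial order `m` on `σ →₀ ℕ` (Mathlib `MonomialOrder σ`),
the WEIGHT ORDER `≺_{w,m}` compares two exponents first by their `w`-weight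
`⟨w, a⟩ = Finsupp.weight w a` and, for equal weights, by `m`. It is again a monomial order
(`weightLex w m`): a well-order on `σ →₀ ℕ` compatible with addition and refining
divisibility. This is the order `≺_ω` of Gröbner-basis theory by which initial ideals with respect
to a weight are reduced to initial MONOMIAL ideals: `in_≺(in_w(I)) = in_{≺_w}(I)` (Sturmfels,
*Gröbner Bases and Convex Polytopes*, Ch. 1, before Prop. 1.8; Cox–Little–O'Shea, Ch. 2 §4,
Exercises 11–12 "weight orders"; Maclagan–Sturmfels §2.4 for the tropical use). It is the device by
which the Gröbner fan, the flatness of Gröbner degenerations and the constancy of Hilbert functions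
under `in_w` are proved; the tree's tropical route (`ResolutionOfSingularities/TropicalLinks`) needs
it for the regularity of tropical compactifications (crux `SchonResolves`, memo
`Cruxes/SchonResolves/KERNEL.md`, (P1)).

## Contents

* `WeightLex w m` — the type synonym of `σ →₀ ℕ` carrying the weight order, with `toWeightLex` /
  `ofWeightLex`, its linear order (`WeightLex.lt_iff`, `WeightLex.le_iff`), ordered cancellative
  additive monoid structure and well-foundedness;
* `weightLex w m : MonomialOrder σ` and the rewriting lemmas `weightLex_lt_iff`,
  `weightLex_le_iff`, `weightLex_le_iff_of_weight_eq`;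
* `weight_degree_weightLex` — the leading exponent of `f ≠ 0` for `≺_{w,m}` has
  weight the `w`-weighted total degree of `f` (it lies on the top `w`-homogeneous component).

Only the case of NATURAL-number weights is treated (then `≺_w` is a well-order for every `m`);
integer or real weights on homogeneous ideals reduce to it by adding a multiple of the grading.

## References

* B. Sturmfels, *Gröbner Bases and Convex Polytopes*, ULS 8, AMS 1996, Ch. 1. [Sturmfels1996GBCP]
* D. Cox, J. Little, D. O'Shea, *Ideals, Varieties, and Algorithms*, 3rd ed. 2007, Ch. 2 §4.
  [CoxLittleOShea2007]
* D. Maclagan, B. Sturmfels, *Introduction to Tropical Geometry*, GSM 161, 2015, §2.4.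
  [MaclaganSturmfels2015]
-/

namespace Literature.RingTheory.MvPolynomial

universe u

open Finsupp

-- the synonym must mention `w` and `m` (it carries THEIR order) although its carrier does not
set_option linter.unusedVariables false in
/-- The type synonym of `σ →₀ ℕ` that carries the weight order `≺_{w,m}`: compare `w`-weights
first, then use the monomial order `m`. [cite: Sturmfels1996GBCP, Ch. 1 (weight term orders `≺_ω`)] -/
@[nolint unusedArguments]
def WeightLex {σ : Type u} (w : σ → ℕ) (m : MonomialOrder σ) : Type u := σ →₀ ℕ

variable {σ : Type u} (w : σ → ℕ) (m : MonomialOrder σ)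

/-- The identity map to the synonym `WeightLex w m`. [folklore] -/
def toWeightLex : (σ →₀ ℕ) ≃ WeightLex w m := Equiv.refl _

/-- The identity map from the synonym `WeightLex w m`. [folklore] -/
def ofWeightLex : WeightLex w m ≃ (σ →₀ ℕ) := Equiv.refl _

variable {w m}

/-- `ofWeightLex ∘ toWeightLex = id`. [folklore] -/
@[simp] theorem ofWeightLex_toWeightLex (a : σ →₀ ℕ) : ofWeightLex w m (toWeightLex w m a) = a := rfl

/-- `toWeightLex ∘ ofWeightLex = id`. [folklore] -/
@[simp] theorem toWeightLex_ofWeightLex (a : WeightLex w m) : toWeightLex w m (ofWeightLex w m a) = a :=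
  rfl

/-- `toWeightLex` is injective. [folklore] -/
theorem toWeightLex_injective : Function.Injective (toWeightLex w m) := fun _ _ h => h

namespace WeightLex

/-- The synonym inherits the additive commutative monoid structure of `σ →₀ ℕ`. [folklore] -/
noncomputable instance : AddCommMonoid (WeightLex w m) := (ofWeightLex w m).addCommMonoid

/-- `toWeightLex` is additive. [folklore] -/
theorem toWeightLex_add (a b : σ →₀ ℕ) :
    toWeightLex w m (a + b) = toWeightLex w m a + toWeightLex w m b := rfl

/-- `ofWeightLex` is additive. [folklore] -/
theorem ofWeightLex_add (a b : WeightLex w m) :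
    ofWeightLex w m (a + b) = ofWeightLex w m a + ofWeightLex w m b := rfl

/-- The comparison key of the weight order: the pair (`w`-weight, `m`-key), ordered
lexicographically. [cite: Sturmfels1996GBCP, Ch. 1] -/
noncomputable def key (a : WeightLex w m) : Lex (ℕ × m.syn) :=
  toLex (weight w (ofWeightLex w m a), m.toSyn (ofWeightLex w m a))

/-- The comparison key is injective (its second component already is). [folklore] -/
theorem key_injective : Function.Injective (key (w := w) (m := m)) := by
  intro a b h
  have h2 := congrArg (fun p : Lex (ℕ × m.syn) => (ofLex p).2) h
  exact m.toSyn.injective h2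

/-- The comparison key is additive. [folklore] -/
theorem key_add (a b : WeightLex w m) : key (a + b) = key a + key b := by
  simp only [key, ofWeightLex_add, map_add]
  rfl

/-- **The weight order** on the synonym: `a < b` iff `⟨w,a⟩ < ⟨w,b⟩`, or the weights agree and
`a ≺_m b` — the linear order pulled back from `Lex (ℕ × m.syn)` along the injective key.
[cite: Sturmfels1996GBCP, Ch. 1] -/
noncomputable instance : LinearOrder (WeightLex w m) := LinearOrder.lift' key key_injective

/-- Unfolding of `≤` through the key. [folklore] -/
theorem le_iff_key_le {a b : WeightLex w m} : a ≤ b ↔ key a ≤ key b := Iff.rfl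

/-- Unfolding of `<` through the key. [folklore] -/
theorem lt_iff_key_lt {a b : WeightLex w m} : a < b ↔ key a < key b := Iff.rfl

/-- **`a < b` in the weight order iff the weight of `a` is smaller, or the weights agree and `a` is
smaller for `m`.** [cite: CoxLittleOShea2007, Ch. 2 §4, Exercise 12] -/
theorem lt_iff {a b : WeightLex w m} :
    a < b ↔ weight w (ofWeightLex w m a) < weight w (ofWeightLex w m b) ∨
      (weight w (ofWeightLex w m a) = weight w (ofWeightLex w m b) ∧
        m.toSyn (ofWeightLex w m a) < m.toSyn (ofWeightLex w m b)) := by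
  rw [lt_iff_key_lt, key, key, Prod.Lex.toLex_lt_toLex]

/-- `a ≤ b` in the weight order iff the weight of `a` is smaller, or the weights agree and `a ≤ b`
for `m`. [folklore] -/
theorem le_iff {a b : WeightLex w m} :
    a ≤ b ↔ weight w (ofWeightLex w m a) < weight w (ofWeightLex w m b) ∨
      (weight w (ofWeightLex w m a) = weight w (ofWeightLex w m b) ∧
        m.toSyn (ofWeightLex w m a) ≤ m.toSyn (ofWeightLex w m b)) := by
  rw [le_iff_key_le, key, key, Prod.Lex.toLex_le_toLex]

/-- The weight order is compatible with addition and cancellative (pulled back along the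
additive injective key). [folklore] -/
instance : IsOrderedCancelAddMonoid (WeightLex w m) :=
  Function.Injective.isOrderedCancelAddMonoid key key_add Iff.rfl

/-- The weight order is a well-order (weights are natural numbers and `m` is a well-order).
[folklore] -/
instance : WellFoundedLT (WeightLex w m) :=
  ⟨InvImage.wf key (wellFounded_lt (α := Lex (ℕ × m.syn)))⟩

end WeightLex

/-! ### The monomial order -/

section Order

variable (w m)

/-- The weight `⟨w, ·⟩` is monotone for the product order on exponents (natural weights).
[folklore] -/
theorem weight_mono_of_le {a b : σ →₀ ℕ} (h : a ≤ b) : weight w a ≤ weight w b := by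
  rw [← add_tsub_cancel_of_le h, map_add]
  exact Nat.le_add_right _ _

/-- **The weight monomial order `≺_{w,m}`** on `σ →₀ ℕ` (a `MonomialOrder` in Mathlib's sense, to
be used like `MonomialOrder.lex` / `MonomialOrder.degLex`): exponents are compared by `w`-weight
first and by `m` for equal weights. It refines the product order because both the weight and `m`
do. [cite: Sturmfels1996GBCP, Ch. 1] -/
noncomputable def weightLex : MonomialOrder σ where
  syn := WeightLex w m
  toSyn := { toEquiv := toWeightLex w m, map_add' := WeightLex.toWeightLex_add }
  toSyn_monotone a b h := by
    change toWeightLex w m a ≤ toWeightLex w m b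
    rw [WeightLex.le_iff]
    simp only [ofWeightLex_toWeightLex]
    rcases (weight_mono_of_le w h).lt_or_eq with hlt | heq
    · exact Or.inl hlt
    · exact Or.inr ⟨heq, m.toSyn_monotone h⟩

variable {w m}

/-- `a ≺_{w,m} b` iff `⟨w,a⟩ < ⟨w,b⟩`, or `⟨w,a⟩ = ⟨w,b⟩` and `a ≺_m b`. [folklore] -/
theorem weightLex_lt_iff {a b : σ →₀ ℕ} :
    (weightLex w m).toSyn a < (weightLex w m).toSyn b ↔
      weight w a < weight w b ∨ (weight w a = weight w b ∧ m.toSyn a < m.toSyn b) :=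
  WeightLex.lt_iff

/-- `a ≼_{w,m} b` iff `⟨w,a⟩ < ⟨w,b⟩`, or `⟨w,a⟩ = ⟨w,b⟩` and `a ≼_m b`. [folklore] -/
theorem weightLex_le_iff {a b : σ →₀ ℕ} :
    (weightLex w m).toSyn a ≤ (weightLex w m).toSyn b ↔
      weight w a < weight w b ∨ (weight w a = weight w b ∧ m.toSyn a ≤ m.toSyn b) :=
  WeightLex.le_iff

/-- The weight is monotone along the weight order: `a ≼_{w,m} b → ⟨w,a⟩ ≤ ⟨w,b⟩`. [folklore] -/
theorem weight_le_of_weightLex_le {a b : σ →₀ ℕ}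
    (h : (weightLex w m).toSyn a ≤ (weightLex w m).toSyn b) : weight w a ≤ weight w b := by
  rcases weightLex_le_iff.1 h with h | h
  · exact h.le
  · exact h.1.le

/-- For equal weights the weight order is `m`: `⟨w,a⟩ = ⟨w,b⟩ → (a ≼_{w,m} b ↔ a ≼_m b)`.
[folklore] -/
theorem weightLex_le_iff_of_weight_eq {a b : σ →₀ ℕ} (h : weight w a = weight w b) :
    (weightLex w m).toSyn a ≤ (weightLex w m).toSyn b ↔ m.toSyn a ≤ m.toSyn b := by
  rw [weightLex_le_iff, h]
  simp only [lt_self_iff_false, true_and, false_or]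

/-- **The leading exponent for `≺_{w,m}` has maximal weight**: for `f ≠ 0`, the `w`-weight of
`deg_{≺_{w,m}}(f)` is the `w`-weighted total degree of `f` — the leading term lies on the top
`w`-homogeneous component `in_w(f)` (max-convention). [cite: Sturmfels1996GBCP, Ch. 1] -/
theorem weight_degree_weightLex {R : Type*} [CommSemiring R] {f : _root_.MvPolynomial σ R}
    (hf : f ≠ 0) :
    weight w ((weightLex w m).degree f) = _root_.MvPolynomial.weightedTotalDegree w f := by
  apply le_antisymm
  · exact _root_.MvPolynomial.le_weightedTotalDegree w ((weightLex w m).degree_mem_support hf)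
  · -- the weighted total degree is attained at some exponent `d`, and `d ≼ deg f`
    classical
    obtain ⟨d, hd, hdeq⟩ := Finset.exists_mem_eq_sup f.support
      (_root_.MvPolynomial.support_nonempty.mpr hf) (fun s => weight w s)
    rw [_root_.MvPolynomial.weightedTotalDegree, hdeq]
    exact weight_le_of_weightLex_le ((weightLex w m).le_degree hd)

end Order

end Literature.RingTheory.MvPolynomial
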